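import Literature.Algebra.Homology.KInjectiveAdjunction
import Mathlib.Algebra.Homology.DerivedCategory.ExactFunctor
import Mathlib.Algebra.Homology.DerivedCategory.Fractions
import HarnessLib

/-!
# The derived functor of an exact left adjoint is faithful on morphisms into a complex whose unit splits

Topic `Algebra/Homology`; namespace `Literature.Algebra.Homology`. Pure homological algebra for Mathlib's
`DerivedCategory`; everything is proved, no named fact, no definition.

SETTING. An adjunction `L ⊣ R` of additive functors between abelian categories `C`, `D` (with derived
categories), `L• ⊣ R•` the induced adjunction on cochain complexes (`mapHomologicalComplexAdj`, termwise, unit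
`η`). Fix a cochain complex `N` over `C` such that

* (split unit) the unit of `N` has a TERMWISE RETRACTION which is a chain map: `r : R• L• N ⟶ N` with
  `η_{Nⁱ} ≫ rⁱ = 𝟙` for every `i`;
* (acyclic resolution) there is a morphism `ι : L• N ⟶ I` into a K-INJECTIVE complex `I` over `D` such that
  `Q (R• ι)` is invertible (`R• ι` a quasi-isomorphism) — e.g. an injective resolution of `L• N` whose terms are
  `R`-acyclic (Leray).

THEN, for every complex `M` over `C`:

* `Q_map_eq_zero_of_unit_retraction` — a chain map `g : M ⟶ N` with `Q (L• g ≫ ι) = 0` in `D(D)` has `Q g = 0`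
  in `D(C)`: `L• g ≫ ι` is null-homotopic (K-injective target, Mathlib `IsKInjective.Qh_map_bijective`), hence so
  is its transpose `g♭ = η_M ≫ R•(L• g ≫ ι) = g ≫ η_N ≫ R• ι` (`Functor.mapHomotopy`, naturality of the unit); and
  `Q (η_N ≫ R• ι)` is a split monomorphism (`(Q R• ι)⁻¹ ≫ Q r` retracts it);
* **`map_mapDerivedCategory_eq_zero_iff`** — when `L` is EXACT (so that Mathlib's `L.mapDerivedCategory = D(L)`
  exists): a morphism `x : Q M ⟶ Q N` of the derived category with `D(L) x = 0` is zero (write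
  `x = (Q s)⁻¹ ≫ Q g` by the right calculus of fractions, Mathlib `DerivedCategory.right_fac`, and use
  `D(L) (Q g) ≅ Q (L• g)`, Mathlib `mapDerivedCategoryFactors`);
* `shift_map_mapDerivedCategory_eq_zero_iff`, **`shiftedHom_map_mapDerivedCategory_eq_zero_iff`** — the same for
  `x : Q M ⟶ (Q N)⟦k⟧` (a degree-`k` class, Mathlib `ShiftedHom`; the hypotheses are asked of `N⟦k⟧`, through
  `Q (N⟦k⟧) ≅ (Q N)⟦k⟧`), in the forms `D(L) x = 0 ↔ x = 0` and `x.map D(L) = 0 ↔ x = 0`;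
* `shiftedHom_map_mapDerivedCategory_injective` — hence `x ↦ x.map D(L)` is injective on `Hom_{D(C)}(Q M, (Q N)⟦k⟧)`.

In print this is the injectivity half of «`Lf^*` is faithful when `𝒪_Y → f_*𝒪_X` splits»: for a finite locally
free `f` of degree invertible on the base, the trace gives the splitting (The Stacks Project, Tag 0BVH) and
`Hom_{D(Y)}(M, N) → Hom_{D(X)}(Lf^*M, Lf^*N) ≅ Hom_{D(Y)}(M, Rf_*Lf^*N)` is `y ↦ y · η_N` (Lipman, Prop. 3.2.3 for
the derived adjunction; Weibel §10.4 for the calculus of fractions). Here NO derived functor of `R` is used or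
constructed: the resolution `ι` replaces `Rf_*`, so the statements only mention `Q`, `L`, `R`, `L•`, `R•` and `D(L)`.

Written for Road №4 of the Hodge atlas (crux stmt-HodgeConjecture-26512, support line «sigma-descent-along-q»,
input (Dq-Inj): `q^{**}` injective on `Ext` along the quotient isogeny `q`), where `L = q^*`, `R = q_*`; nothing in
this file refers to it.

## References

* J. Lipman, *Notes on derived functors and Grothendieck duality*, LNM 1960 (2009), Prop. 3.2.3. [Lipman2009]
* N. Spaltenstein, *Resolutions of unbounded complexes*, Compositio Math. 65 (1988), Prop. 1.5. [Spaltenstein1988]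
* The Stacks Project, Tag 0BVH (trace splitting of `𝒪_Y → f_*𝒪_X`), Tag 0DVC. [StacksProject]
* C. A. Weibel, *An introduction to homological algebra* (1994), §10.3–10.4 (calculus of fractions, Cor. 10.4.7). [Weibel1994]
-/

noncomputable section

-- implicit objects of the form `(F ⋙ G).obj X` / `(𝟭 _).obj X` in units and factorisation isomorphisms (as in
-- `Literature/Algebra/Homology/KInjectiveAdjunction.lean`'s clients under `AlgebraicGeometry/Modules`).
set_option backward.isDefEq.respectTransparency false

open CategoryTheory CategoryTheory.Category CategoryTheory.Limits

namespace Literature.Algebra.Homology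

universe w w' v v' u u'

variable {C : Type u} [Category.{v} C] [Abelian C] {D : Type u'} [Category.{v'} D] [Abelian D]
  {L : C ⥤ D} {R : D ⥤ C} (adj : L ⊣ R) [L.Additive] [R.Additive]
  [HasDerivedCategory.{w} C] [HasDerivedCategory.{w'} D]

/-! ### Chain maps -/

omit [HasDerivedCategory.{w} C] in
/-- A chain map into a K-injective complex which vanishes in the derived category is null-homotopic
(Mathlib `CochainComplex.IsKInjective.Qh_map_bijective`, transported along `quotient ⋙ Qh ≅ Q`).
[cite: Spaltenstein1988, Prop. 1.5] -/
theorem quotient_map_eq_zero_of_Q_map_eq_zero {K I : CochainComplex D ℤ} [I.IsKInjective] (f : K ⟶ I)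
    (h : DerivedCategory.Q.map f = 0) :
    (HomotopyCategory.quotient D (ComplexShape.up ℤ)).map f = 0 := by
  apply (CochainComplex.IsKInjective.Qh_map_bijective _ I).1
  have h' : DerivedCategory.Qh.map ((HomotopyCategory.quotient D (ComplexShape.up ℤ)).map f) ≫
      ((DerivedCategory.quotientCompQhIso D).app I).hom = 0 := by
    rw [Iso.app_hom, DerivedCategory.quotientCompQhIso_hom_naturality, h, comp_zero]
  rw [Functor.map_zero, ((DerivedCategory.quotientCompQhIso D).app I).eq_comp_inv.mpr h', zero_comp]

omit [HasDerivedCategory.{w} C] [HasDerivedCategory.{w'} D] in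
/-- The unit of `L• ⊣ R•` followed by a termwise retraction is the identity chain map (plumbing). [folklore] -/
private theorem unit_app_comp_eq_id_of_termwise {N : CochainComplex C ℤ}
    (r : (R.mapHomologicalComplex (ComplexShape.up ℤ)).obj ((L.mapHomologicalComplex (ComplexShape.up ℤ)).obj N) ⟶ N)
    (hr : ∀ i, adj.unit.app (N.X i) ≫ r.f i = 𝟙 (N.X i)) :
    (mapHomologicalComplexAdj adj (ComplexShape.up ℤ)).unit.app N ≫ r = 𝟙 N := by
  ext i
  rw [HomologicalComplex.comp_f, mapHomologicalComplexAdj_unit_app_f, HomologicalComplex.id_f]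
  exact hr i

/-- **A chain map `g : M ⟶ N` dies in `D(C)` as soon as `L• g ≫ ι` dies in `D(D)`**, for `ι : L• N ⟶ I` into a
K-injective complex with `Q (R• ι)` invertible and the unit of `N` split termwise by a chain map `r`:
`Q (L• g ≫ ι) = 0 ⟹ Q g = 0`. (`L• g ≫ ι ∼ 0` by K-injectivity; its transpose `g♭ = η_M ≫ R•(L• g ≫ ι) ∼ 0` equals
`g ≫ η_N ≫ R• ι`, and `Q(η_N ≫ R• ι)` is retracted by `(Q R• ι)⁻¹ ≫ Q r`.)
[cite: Lipman2009, Prop. 3.2.3] [cite: StacksProject, Tag 0BVH] -/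
theorem Q_map_eq_zero_of_unit_retraction {M N : CochainComplex C ℤ} (g : M ⟶ N)
    (r : (R.mapHomologicalComplex (ComplexShape.up ℤ)).obj ((L.mapHomologicalComplex (ComplexShape.up ℤ)).obj N) ⟶ N)
    (hr : ∀ i, adj.unit.app (N.X i) ≫ r.f i = 𝟙 (N.X i))
    {I : CochainComplex D ℤ} [I.IsKInjective] (ι : (L.mapHomologicalComplex (ComplexShape.up ℤ)).obj N ⟶ I)
    (hι : IsIso (DerivedCategory.Q.map ((R.mapHomologicalComplex (ComplexShape.up ℤ)).map ι)))
    (h : DerivedCategory.Q.map ((L.mapHomologicalComplex (ComplexShape.up ℤ)).map g ≫ ι) = 0) :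
    DerivedCategory.Q.map g = 0 := by
  haveI := hι
  -- the transpose `g♭ : M ⟶ R• I` of `L• g ≫ ι`
  set φ : M ⟶ (R.mapHomologicalComplex (ComplexShape.up ℤ)).obj I :=
    (mapHomologicalComplexAdj adj (ComplexShape.up ℤ)).homEquiv M I
      ((L.mapHomologicalComplex (ComplexShape.up ℤ)).map g ≫ ι) with hφ
  -- (1) `g♭ ∼ 0`, hence `Q g♭ = 0`
  have hφ0 : DerivedCategory.Q.map φ = 0 := by
    obtain ⟨H⟩ := (HomotopyCategory.quotient_map_eq_zero_iff _).mp (quotient_map_eq_zero_of_Q_map_eq_zero _ h)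
    have H' : Homotopy φ 0 := by
      rw [hφ, Adjunction.homEquiv_unit]
      exact ((R.mapHomotopy H).compLeft _).trans (Homotopy.ofEq (by rw [Functor.map_zero, comp_zero]))
    rw [DerivedCategory.Q_map_eq_of_homotopy (h := H'), Functor.map_zero]
  -- (2) `g♭ = g ≫ ι♭` with `ι♭ = η_N ≫ R• ι`
  have hφg : φ = g ≫ (mapHomologicalComplexAdj adj (ComplexShape.up ℤ)).homEquiv N I ι := by
    rw [hφ, Adjunction.homEquiv_naturality_left]
  -- (3) `Q ι♭` is a split monomorphism
  have hsplit : DerivedCategory.Q.map ((mapHomologicalComplexAdj adj (ComplexShape.up ℤ)).homEquiv N I ι) ≫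
      inv (DerivedCategory.Q.map ((R.mapHomologicalComplex (ComplexShape.up ℤ)).map ι)) ≫ DerivedCategory.Q.map r =
        𝟙 _ := by
    rw [Adjunction.homEquiv_unit, Functor.map_comp, assoc, IsIso.hom_inv_id_assoc, ← Functor.map_comp,
      unit_app_comp_eq_id_of_termwise adj r hr, CategoryTheory.Functor.map_id]
  calc DerivedCategory.Q.map g
      = DerivedCategory.Q.map g ≫
          (DerivedCategory.Q.map ((mapHomologicalComplexAdj adj (ComplexShape.up ℤ)).homEquiv N I ι) ≫
            inv (DerivedCategory.Q.map ((R.mapHomologicalComplex (ComplexShape.up ℤ)).map ι)) ≫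
              DerivedCategory.Q.map r) := by rw [hsplit, comp_id]
    _ = DerivedCategory.Q.map φ ≫ inv (DerivedCategory.Q.map ((R.mapHomologicalComplex (ComplexShape.up ℤ)).map ι)) ≫
          DerivedCategory.Q.map r := by rw [hφg, Functor.map_comp, assoc]
    _ = 0 := by rw [hφ0, zero_comp]

/-! ### Morphisms of the derived category, `L` exact -/

section Exact

variable [PreservesFiniteLimits L] [PreservesFiniteColimits L]

omit [R.Additive] in
/-- `D(L)` kills `Q g` iff `L• g` dies in `D(D)` (Mathlib `mapDerivedCategoryFactors : Q ⋙ D(L) ≅ L• ⋙ Q`).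
[cite: Weibel1994, §10.4 and Cor. 10.4.7] -/
theorem mapDerivedCategory_map_Q_map_eq_zero_iff {M N : CochainComplex C ℤ} (g : M ⟶ N) :
    L.mapDerivedCategory.map (DerivedCategory.Q.map g) = 0 ↔
      DerivedCategory.Q.map ((L.mapHomologicalComplex (ComplexShape.up ℤ)).map g) = 0 := by
  have hnat := L.mapDerivedCategoryFactors_hom_naturality g
  constructor
  · intro h
    rw [h, zero_comp] at hnat
    rw [(L.mapDerivedCategoryFactors.app M).eq_inv_comp.mpr hnat.symm, comp_zero]
  · intro h
    rw [h, comp_zero] at hnat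
    rw [(L.mapDerivedCategoryFactors.app N).eq_comp_inv.mpr hnat, zero_comp]

/-- **`D(L)` IS FAITHFUL ON `Hom_{D(C)}(Q M, Q N)` WHEN THE UNIT OF `N` SPLITS AND `L• N` HAS AN `R`-ACYCLIC K-INJECTIVE
RESOLUTION**: for `x : Q M ⟶ Q N`, `D(L) x = 0 ↔ x = 0`. Write `x = (Q s)⁻¹ ≫ Q g` with `s` a quasi-isomorphism
(Mathlib `DerivedCategory.right_fac`); then `D(L)(Q g) = 0`, i.e. `Q (L• g) = 0`, and `Q_map_eq_zero_of_unit_retraction`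
gives `Q g = 0`. [cite: Lipman2009, Prop. 3.2.3] [cite: Weibel1994, §10.4 and Cor. 10.4.7] [cite: StacksProject, Tag 0BVH] -/
theorem map_mapDerivedCategory_eq_zero_iff {M N : CochainComplex C ℤ}
    (r : (R.mapHomologicalComplex (ComplexShape.up ℤ)).obj ((L.mapHomologicalComplex (ComplexShape.up ℤ)).obj N) ⟶ N)
    (hr : ∀ i, adj.unit.app (N.X i) ≫ r.f i = 𝟙 (N.X i))
    {I : CochainComplex D ℤ} [I.IsKInjective] (ι : (L.mapHomologicalComplex (ComplexShape.up ℤ)).obj N ⟶ I)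
    (hι : IsIso (DerivedCategory.Q.map ((R.mapHomologicalComplex (ComplexShape.up ℤ)).map ι)))
    (x : DerivedCategory.Q.obj M ⟶ DerivedCategory.Q.obj N) :
    L.mapDerivedCategory.map x = 0 ↔ x = 0 := by
  refine ⟨fun hx => ?_, fun hx => by rw [hx, Functor.map_zero]⟩
  obtain ⟨M', s, hs, g, rfl⟩ := DerivedCategory.right_fac x
  have hg : L.mapDerivedCategory.map (DerivedCategory.Q.map g) = 0 := by
    have : DerivedCategory.Q.map g =
        DerivedCategory.Q.map s ≫ (inv (DerivedCategory.Q.map s) ≫ DerivedCategory.Q.map g) := by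
      rw [IsIso.hom_inv_id_assoc]
    rw [this, Functor.map_comp, hx, comp_zero]
  have hLg := (mapDerivedCategory_map_Q_map_eq_zero_iff (L := L) g).mp hg
  rw [Q_map_eq_zero_of_unit_retraction adj g r hr ι hι (by rw [Functor.map_comp, hLg, zero_comp]), comp_zero]

/-- **The same for degree-`k` classes `x : Q M ⟶ (Q N)⟦k⟧`**, the hypotheses being asked of `N⟦k⟧` (through Mathlib's
`Q (N⟦k⟧) ≅ (Q N)⟦k⟧`, `DerivedCategory.Q.commShiftIso`): `D(L) x = 0 ↔ x = 0`.
[cite: Lipman2009, Prop. 3.2.3] [cite: Weibel1994, §10.4 and Cor. 10.4.7] -/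
theorem shift_map_mapDerivedCategory_eq_zero_iff {M N : CochainComplex C ℤ} (k : ℤ)
    (r : (R.mapHomologicalComplex (ComplexShape.up ℤ)).obj ((L.mapHomologicalComplex (ComplexShape.up ℤ)).obj (N⟦k⟧)) ⟶ N⟦k⟧)
    (hr : ∀ i, adj.unit.app ((N⟦k⟧).X i) ≫ r.f i = 𝟙 ((N⟦k⟧).X i))
    {I : CochainComplex D ℤ} [I.IsKInjective] (ι : (L.mapHomologicalComplex (ComplexShape.up ℤ)).obj (N⟦k⟧) ⟶ I)
    (hι : IsIso (DerivedCategory.Q.map ((R.mapHomologicalComplex (ComplexShape.up ℤ)).map ι)))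
    (x : DerivedCategory.Q.obj M ⟶ (DerivedCategory.Q.obj N)⟦k⟧) :
    L.mapDerivedCategory.map x = 0 ↔ x = 0 := by
  refine ⟨fun hx => ?_, fun hx => by rw [hx, Functor.map_zero]⟩
  have h0 : x ≫ (DerivedCategory.Q.commShiftIso k).inv.app N = 0 :=
    (map_mapDerivedCategory_eq_zero_iff adj r hr ι hι (x ≫ (DerivedCategory.Q.commShiftIso k).inv.app N)).mp
      (by rw [Functor.map_comp, hx, zero_comp])
  have hx' : x = (x ≫ (DerivedCategory.Q.commShiftIso k).inv.app N) ≫ (DerivedCategory.Q.commShiftIso k).hom.app N := by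
    rw [assoc, Iso.inv_hom_id_app]
    exact (comp_id x).symm
  rw [hx', h0, zero_comp]

/-- **The same in Mathlib's `ShiftedHom` language**: for `x : ShiftedHom (Q M) (Q N) k`, `x.map D(L) = 0 ↔ x = 0`
(`x.map D(L) = D(L) x ≫ (D(L).commShiftIso k).hom`). [cite: Lipman2009, Prop. 3.2.3] [cite: Weibel1994, §10.4 and Cor. 10.4.7] -/
theorem shiftedHom_map_mapDerivedCategory_eq_zero_iff {M N : CochainComplex C ℤ} (k : ℤ)
    (r : (R.mapHomologicalComplex (ComplexShape.up ℤ)).obj ((L.mapHomologicalComplex (ComplexShape.up ℤ)).obj (N⟦k⟧)) ⟶ N⟦k⟧)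
    (hr : ∀ i, adj.unit.app ((N⟦k⟧).X i) ≫ r.f i = 𝟙 ((N⟦k⟧).X i))
    {I : CochainComplex D ℤ} [I.IsKInjective] (ι : (L.mapHomologicalComplex (ComplexShape.up ℤ)).obj (N⟦k⟧) ⟶ I)
    (hι : IsIso (DerivedCategory.Q.map ((R.mapHomologicalComplex (ComplexShape.up ℤ)).map ι)))
    (x : ShiftedHom (DerivedCategory.Q.obj M) (DerivedCategory.Q.obj N) k) :
    x.map L.mapDerivedCategory = 0 ↔ x = 0 := by
  rw [← shift_map_mapDerivedCategory_eq_zero_iff adj k r hr ι hι x, ShiftedHom.map]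
  constructor
  · intro h
    rw [((L.mapDerivedCategory.commShiftIso k).app (DerivedCategory.Q.obj N)).eq_comp_inv.mpr h, zero_comp]
  · intro h
    rw [h, zero_comp]

/-- **`x ↦ x.map D(L)` IS INJECTIVE on `Hom_{D(C)}(Q M, (Q N)⟦k⟧)`** under the two hypotheses on `N⟦k⟧` (unit split
termwise by a chain map, `R`-acyclic K-injective resolution of `L•(N⟦k⟧)`). [cite: Lipman2009, Prop. 3.2.3] [cite: StacksProject, Tag 0BVH] -/
theorem shiftedHom_map_mapDerivedCategory_injective (M N : CochainComplex C ℤ) (k : ℤ)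
    (r : (R.mapHomologicalComplex (ComplexShape.up ℤ)).obj ((L.mapHomologicalComplex (ComplexShape.up ℤ)).obj (N⟦k⟧)) ⟶ N⟦k⟧)
    (hr : ∀ i, adj.unit.app ((N⟦k⟧).X i) ≫ r.f i = 𝟙 ((N⟦k⟧).X i))
    {I : CochainComplex D ℤ} [I.IsKInjective] (ι : (L.mapHomologicalComplex (ComplexShape.up ℤ)).obj (N⟦k⟧) ⟶ I)
    (hι : IsIso (DerivedCategory.Q.map ((R.mapHomologicalComplex (ComplexShape.up ℤ)).map ι))) :
    Function.Injective fun x : ShiftedHom (DerivedCategory.Q.obj M) (DerivedCategory.Q.obj N) k =>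
      x.map L.mapDerivedCategory := by
  intro x y hxy
  rw [← sub_eq_zero, ← shiftedHom_map_mapDerivedCategory_eq_zero_iff adj k r hr ι hι (x - y), ShiftedHom.map,
    Functor.map_sub, Preadditive.sub_comp, sub_eq_zero]
  exact hxy

end Exact

end Literature.Algebra.Homology

end
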